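import Literature.NumberTheory.Sieve.MaynardNFBilinear
import Literature.NumberTheory.Sieve.MaynardSieveLemma53
import HarnessLib

/-!
# The Maynard–Tao sieve over `𝓞_K`: relaxing "good" tuples to coordinatewise good tuples (Maynard's (6.5))

Topic `Literature/NumberTheory/Sieve`. In the evaluation of the main terms of Proposition 2.1 of
A. Castillo, C. Hall, R. J. Lemke Oliver, P. Pollack, L. Thompson, *Bounded gaps between primes in
number fields and function fields*, Proc. AMS 143 (2015) = arXiv:1403.5808 (following Maynard 2015,
proof of Lemma 6.2, display (6.5)), the diagonal sum `∑_{𝔲 good} (∏ᵢ 1/φ(𝔲ᵢ)) F(x_𝔲)²` is first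
relaxed to the sum over the coordinatewise good tuples (each `𝔲ᵢ` squarefree and coprime to `𝔴`):
a coordinatewise good tuple that is not good has two coordinates sharing a prime factor `𝔭 ∤ 𝔴`,
hence `N𝔭 > D₀`, and the total weight of such tuples is `≪ k² L^k ∑_{N𝔭 > D₀} 1/(N𝔭 − 1)²`.
Everything in this file is PROVED (theorems only); it is the number-field port of the corresponding
lemmas of the tree's `MaynardSieveLemma62.lean`.

* `squarefree_prod_of_pairwise'`, `exists_prime_dvd_two_of_not_isGood` — the common prime factor;
* `sum_G1_filter_dvd_inv_idealTotient_le` — `∑_{𝔞 ∈ G1, 𝔭 ∣ 𝔞} 1/φ(𝔞) ≤ L/(N𝔭 − 1)`;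
* `sum_prod_inv_idealTotient_filter_dvd_le` — the tuples with `𝔭 ∣ 𝔲ᵢ`, `𝔭 ∣ 𝔲ⱼ` weigh
  `≤ L^k/(N𝔭 − 1)²` (the union bound is the tree's `MaynardSieve.sum_filter_exists_le`);
* **`sum_prod_inv_idealTotient_not_isGood_le`** — the bad tuples weigh
  `≤ k² L^k ∑_{𝔭 ∈ T, 𝔭 ∤ 𝔴} 1/(N𝔭 − 1)²`, `T` the primes of norm `≤ B`.

## References

* Castillo–Hall–Lemke Oliver–Pollack–Thompson, arXiv:1403.5808, proof of Proposition 2.1.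
  [CastilloEtAl2015]
* J. Maynard, *Small gaps between primes*, Ann. of Math. 181 (2015), proof of Lemma 6.2, (6.5).
  [MaynardAnnals2015]
-/

noncomputable section

open Finset UniqueFactorizationMonoid NumberField IsDedekindDomain
open scoped NumberField Classical

namespace Literature.NumberTheory.Sieve.MaynardNF

open Literature.NumberTheory.LFunctions Literature.NumberTheory.LFunctions.NumberField

variable {K : Type*} [Field K] [NumberField K]
variable {k : ℕ}

/-! ### The common prime factor of a bad tuple -/

/-- A product of pairwise comaximal squarefree ideals is squarefree. [folklore] -/
theorem squarefree_prod_of_pairwise' {ι : Type*} (t : Finset ι) (f : ι → Ideal (𝓞 K))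
    (hsq : ∀ i ∈ t, Squarefree (f i)) (h : ∀ i ∈ t, ∀ j ∈ t, i ≠ j → f i ⊔ f j = ⊤) :
    Squarefree (∏ i ∈ t, f i) := by
  induction t using Finset.induction_on with
  | empty => simp
  | insert a t hat ih =>
    rw [Finset.prod_insert hat]
    have hcop : f a ⊔ ∏ x ∈ t, f x = ⊤ :=
      Ideal.sup_prod_eq_top fun i hi => h a (Finset.mem_insert_self _ _) i
        (Finset.mem_insert_of_mem hi) (fun hai => hat (hai ▸ hi))
    exact squarefree_mul_iff.2 ⟨Ideal.isRelPrime_iff_sup_eq_top.2 hcop,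
      hsq a (Finset.mem_insert_self _ _),
      ih (fun i hi => hsq i (Finset.mem_insert_of_mem hi))
        (fun i hi j hj hij => h i (Finset.mem_insert_of_mem hi) j (Finset.mem_insert_of_mem hj) hij)⟩

/-- **A coordinatewise good tuple which is not good has two coordinates with a common prime factor
`𝔭`, of norm `≤ B` and not dividing `𝔴`** (so `N𝔭 > D₀` when every prime of norm `≤ D₀` divides
`𝔴`). [cite: MaynardAnnals2015, proof of Lemma 6.2, before (6.5)] -/
theorem exists_prime_dvd_two_of_not_isGood {𝔴 : Ideal (𝓞 K)} {B : ℝ}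
    {𝔲 : Fin k → Ideal (𝓞 K)} (hu : ∀ i, 𝔲 i ∈ G1 K 𝔴 B) (hng : ¬IsGood 𝔴 𝔲) :
    ∃ ij ∈ (Finset.univ : Finset (Fin k)).offDiag,
      ∃ P ∈ ((finite_primeIdealsLE K B).toFinset).filter (fun P => ¬ P ∣ 𝔴),
        P ∣ 𝔲 ij.1 ∧ P ∣ 𝔲 ij.2 := by
  classical
  have hu' := fun i => mem_G1.1 (hu i)
  have hcop : (∏ i, 𝔲 i) ⊔ 𝔴 = ⊤ := Ideal.prod_sup_eq_top fun i _ => (hu' i).2.2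
  have hnsq : ¬Squarefree (∏ i, 𝔲 i) := fun h => hng ⟨h, hcop⟩
  -- two coordinates are not comaximal
  have hex : ∃ i j, i ≠ j ∧ ¬ (𝔲 i ⊔ 𝔲 j = ⊤) := by
    by_contra hcon
    push Not at hcon
    exact hnsq (squarefree_prod_of_pairwise' Finset.univ 𝔲 (fun i _ => (hu' i).2.1)
      fun i _ j _ hij => hcon i j hij)
  obtain ⟨i, j, hij, hnc⟩ := hex
  obtain ⟨P, hPmax, hle⟩ := Ideal.exists_le_maximal _ hnc
  have hPi : P ∣ 𝔲 i := Ideal.dvd_iff_le.2 (le_sup_left.trans hle)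
  have hPj : P ∣ 𝔲 j := Ideal.dvd_iff_le.2 (le_sup_right.trans hle)
  have hP0 : P ≠ ⊥ := fun h0 => (hu' i).1.1 (le_bot_iff.1 (h0 ▸ (le_sup_left.trans hle)))
  have hPprime : P.IsPrime := hPmax.isPrime
  refine ⟨(i, j), Finset.mem_offDiag.2 ⟨Finset.mem_univ _, Finset.mem_univ _, hij⟩, P,
    Finset.mem_filter.2 ⟨?_, fun hPw => ?_⟩, hPi, hPj⟩
  · rw [Set.Finite.mem_toFinset]
    refine ⟨hPprime, hP0, ?_⟩
    have hN0 : Ideal.absNorm (𝔲 i) ≠ 0 := by rw [Ne, Ideal.absNorm_eq_zero_iff]; exact (hu' i).1.1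
    calc (Ideal.absNorm P : ℝ) ≤ Ideal.absNorm (𝔲 i) := by
          exact_mod_cast Nat.le_of_dvd (Nat.pos_of_ne_zero hN0) (map_dvd _ hPi)
      _ ≤ B := (hu' i).1.2
  · -- `P ∣ 𝔴` contradicts `𝔲 i + 𝔴 = (1)`
    have : 𝔲 i ⊔ 𝔴 ≤ P := sup_le (Ideal.le_of_dvd hPi) (Ideal.le_of_dvd hPw)
    rw [(hu' i).2.2, top_le_iff] at this
    exact hPmax.ne_top this

/-! ### The weight of the tuples through a fixed prime -/

/-- `∑_{𝔞 ∈ G1, 𝔭 ∣ 𝔞} 1/φ(𝔞) ≤ (1/φ(𝔭)) ∑_{𝔞 ∈ G1} 1/φ(𝔞)` for a prime `𝔭` (`𝔞 = 𝔭𝔞'`, `𝔞'` squarefree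
coprime to `𝔭`, `φ(𝔞) = φ(𝔭)φ(𝔞')`, `𝔞' ∈ G1`). [cite: MaynardAnnals2015, proof of Lemma 6.2, (6.5)] -/
theorem sum_G1_filter_dvd_inv_idealTotient_le {𝔴 : Ideal (𝓞 K)} {B : ℝ} {P : Ideal (𝓞 K)}
    (hP : Prime P) :
    ∑ 𝔞 ∈ (G1 K 𝔴 B).filter (fun 𝔞 => P ∣ 𝔞), 1 / idealTotient K 𝔞 ≤
      1 / idealTotient K P * ∑ 𝔞 ∈ G1 K 𝔴 B, 1 / idealTotient K 𝔞 := by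
  have hP0 : P ≠ ⊥ := fun h => hP.ne_zero (h.trans Ideal.zero_eq_bot.symm)
  have hφP : 0 < idealTotient K P := idealTotient_pos hP0
  have hinj : Set.InjOn (cof P) ((G1 K 𝔴 B).filter (fun 𝔞 => P ∣ 𝔞) : Set (Ideal (𝓞 K))) := by
    intro 𝔞 ha 𝔞' ha' h
    rw [Finset.mem_coe, Finset.mem_filter] at ha ha'
    rw [eq_mul_cof ha.2, eq_mul_cof ha'.2, h]
  -- `φ(𝔞) = φ(P) φ(cof P 𝔞)` on squarefree `𝔞`
  have hmul : ∀ 𝔞 ∈ (G1 K 𝔴 B).filter (fun 𝔞 => P ∣ 𝔞),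
      idealTotient K 𝔞 = idealTotient K P * idealTotient K (cof P 𝔞) := by
    intro 𝔞 ha
    rw [Finset.mem_filter] at ha
    have hsq : Squarefree 𝔞 := (mem_G1.1 ha.1).2.1
    have heq := eq_mul_cof ha.2
    conv_lhs => rw [heq]
    refine idealTotient_mul_of_coprime _ _ (sup_eq_top_of_squarefree_mul (𝔯 := P) (𝔪 := cof P 𝔞) ?_)
    rw [← heq]; exact hsq
  calc ∑ 𝔞 ∈ (G1 K 𝔴 B).filter (fun 𝔞 => P ∣ 𝔞), 1 / idealTotient K 𝔞
      = ∑ 𝔞 ∈ (G1 K 𝔴 B).filter (fun 𝔞 => P ∣ 𝔞),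
          1 / idealTotient K P * (1 / idealTotient K (cof P 𝔞)) := by
        refine Finset.sum_congr rfl fun 𝔞 ha => ?_
        rw [hmul 𝔞 ha, one_div_mul_one_div]
    _ = 1 / idealTotient K P * ∑ 𝔞' ∈ ((G1 K 𝔴 B).filter (fun 𝔞 => P ∣ 𝔞)).image (cof P),
          1 / idealTotient K 𝔞' := by
        rw [Finset.mul_sum, Finset.sum_image hinj]
    _ ≤ 1 / idealTotient K P * ∑ 𝔞 ∈ G1 K 𝔴 B, 1 / idealTotient K 𝔞 := by
        refine mul_le_mul_of_nonneg_left ?_ (by positivity)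
        refine Finset.sum_le_sum_of_subset_of_nonneg (fun 𝔞' ha' => ?_) fun 𝔞 ha _ =>
          (one_div_pos.2 (idealTotient_pos (mem_G1.1 ha).1.1)).le
        rw [Finset.mem_image] at ha'
        obtain ⟨𝔞, ha, rfl⟩ := ha'
        rw [Finset.mem_filter] at ha
        exact mem_G1_of_dvd ha.1 ⟨P, by rw [mul_comm]; exact eq_mul_cof ha.2⟩

/-- **The tuples with `𝔭 ∣ 𝔲ᵢ`, `𝔭 ∣ 𝔲ⱼ` (`i ≠ j`) weigh `≤ L^k/φ(𝔭)²`**, `L = ∑_{𝔞 ∈ G1} 1/φ(𝔞)`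
(the filtered box is a product box with two coordinates through `𝔭`).
[cite: MaynardAnnals2015, proof of Lemma 6.2, (6.5)] -/
theorem sum_prod_inv_idealTotient_filter_dvd_le {𝔴 : Ideal (𝓞 K)} {B : ℝ}
    {P : Ideal (𝓞 K)} (hP : Prime P) {i j : Fin k} (hij : i ≠ j) :
    ∑ 𝔲 ∈ (Fintype.piFinset fun _ : Fin k => G1 K 𝔴 B).filter (fun 𝔲 => P ∣ 𝔲 i ∧ P ∣ 𝔲 j),
        ∏ l, 1 / idealTotient K (𝔲 l) ≤
      (∑ 𝔞 ∈ G1 K 𝔴 B, 1 / idealTotient K 𝔞) ^ k / idealTotient K P ^ 2 := by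
  classical
  set L := ∑ 𝔞 ∈ G1 K 𝔴 B, 1 / idealTotient K 𝔞 with hL
  set Lp := ∑ 𝔞 ∈ (G1 K 𝔴 B).filter (fun 𝔞 => P ∣ 𝔞), 1 / idealTotient K 𝔞 with hLp
  have hP0 : P ≠ ⊥ := fun h => hP.ne_zero (h.trans Ideal.zero_eq_bot.symm)
  have hφP : 0 < idealTotient K P := idealTotient_pos hP0
  have hpos : ∀ 𝔞 ∈ G1 K 𝔴 B, 0 ≤ 1 / idealTotient K 𝔞 := fun 𝔞 ha =>
    (one_div_pos.2 (idealTotient_pos (mem_G1.1 ha).1.1)).le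
  have hL0 : 0 ≤ L := Finset.sum_nonneg hpos
  have hLp0 : 0 ≤ Lp := Finset.sum_nonneg fun 𝔞 ha => hpos 𝔞 (Finset.mem_filter.1 ha).1
  have hLpL : Lp ≤ 1 / idealTotient K P * L := sum_G1_filter_dvd_inv_idealTotient_le hP
  -- the filtered box is a product box
  set T : Fin k → Finset (Ideal (𝓞 K)) := fun l =>
    if l = i ∨ l = j then (G1 K 𝔴 B).filter (fun 𝔞 => P ∣ 𝔞) else G1 K 𝔴 B with hT
  have hset : (Fintype.piFinset fun _ : Fin k => G1 K 𝔴 B).filter (fun 𝔲 => P ∣ 𝔲 i ∧ P ∣ 𝔲 j) =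
      Fintype.piFinset T := by
    ext 𝔲
    simp only [Finset.mem_filter, Fintype.mem_piFinset, hT]
    constructor
    · rintro ⟨h, hi, hj⟩ l
      by_cases hl : l = i ∨ l = j
      · rw [if_pos hl, Finset.mem_filter]
        rcases hl with rfl | rfl
        · exact ⟨h l, hi⟩
        · exact ⟨h l, hj⟩
      · rw [if_neg hl]; exact h l
    · intro h
      have hmem : ∀ l, 𝔲 l ∈ G1 K 𝔴 B := fun l => by
        have := h l
        by_cases hl : l = i ∨ l = j
        · rw [if_pos hl, Finset.mem_filter] at this; exact this.1
        · rwa [if_neg hl] at this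
      have hi := h i
      have hj := h j
      rw [if_pos (Or.inl rfl), Finset.mem_filter] at hi
      rw [if_pos (Or.inr rfl), Finset.mem_filter] at hj
      exact ⟨hmem, hi.2, hj.2⟩
  rw [hset, ← Finset.prod_univ_sum T (fun _ 𝔞 => 1 / idealTotient K 𝔞)]
  have hfac : ∀ l, ∑ 𝔞 ∈ T l, 1 / idealTotient K 𝔞 = if l = i ∨ l = j then Lp else L := by
    intro l
    by_cases hl : l = i ∨ l = j
    · simp only [hT, if_pos hl, hLp]
    · simp only [hT, if_neg hl, hL]
  simp_rw [hfac]
  rw [← Finset.mul_prod_erase _ _ (Finset.mem_univ i), if_pos (Or.inl rfl),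
    ← Finset.mul_prod_erase _ _ (Finset.mem_erase.2 ⟨hij.symm, Finset.mem_univ j⟩),
    if_pos (Or.inr rfl)]
  have hrest : ∏ x ∈ (Finset.univ.erase i).erase j, (if x = i ∨ x = j then Lp else L) = L ^ (k - 2) := by
    calc _ = ∏ x ∈ (Finset.univ.erase i).erase j, L := by
          refine Finset.prod_congr rfl fun x hx => ?_
          rw [Finset.mem_erase, Finset.mem_erase] at hx
          rw [if_neg (not_or.2 ⟨hx.2.1, hx.1⟩)]
      _ = L ^ (k - 2) := by
          rw [Finset.prod_const]
          congr 1
          rw [Finset.card_erase_of_mem (Finset.mem_erase.2 ⟨hij.symm, Finset.mem_univ j⟩),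
            Finset.card_erase_of_mem (Finset.mem_univ i), Finset.card_univ, Fintype.card_fin]
          omega
  rw [hrest]
  have hk2 : 2 ≤ k := by
    have h2 : ({i, j} : Finset (Fin k)).card ≤ Fintype.card (Fin k) := Finset.card_le_univ _
    rw [Finset.card_pair hij, Fintype.card_fin] at h2
    exact h2
  have hφP' : 0 ≤ 1 / idealTotient K P := (one_div_pos.2 hφP).le
  have hLk0 : 0 ≤ L ^ (k - 2) := pow_nonneg hL0 _
  have h1 : Lp * (Lp * L ^ (k - 2)) ≤
      (1 / idealTotient K P * L) * ((1 / idealTotient K P * L) * L ^ (k - 2)) :=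
    mul_le_mul hLpL (mul_le_mul_of_nonneg_right hLpL hLk0) (mul_nonneg hLp0 hLk0)
      (mul_nonneg hφP' hL0)
  have h2 : (1 / idealTotient K P * L) * ((1 / idealTotient K P * L) * L ^ (k - 2)) =
      L ^ k / idealTotient K P ^ 2 := by
    have hLk : L ^ k = L ^ (k - 2) * L ^ 2 := by rw [← pow_add, Nat.sub_add_cancel hk2]
    rw [hLk]
    field_simp
  exact h1.trans h2.le

/-- **The bad tuples** (Maynard's (6.5) over `𝓞_K`): the total weight `∏ᵢ 1/φ(𝔲ᵢ)` of the
coordinatewise good tuples that are not good is at most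
`k² L^k ∑_{𝔭 ∈ T, 𝔭 ∤ 𝔴} 1/φ(𝔭)²`, `T` the prime ideals of norm `≤ B`, `L = ∑_{𝔞 ∈ G1} 1/φ(𝔞)`.
[cite: MaynardAnnals2015, proof of Lemma 6.2, (6.5)] -/
theorem sum_prod_inv_idealTotient_not_isGood_le (𝔴 : Ideal (𝓞 K)) (B : ℝ) :
    ∑ 𝔲 ∈ (Fintype.piFinset fun _ : Fin k => G1 K 𝔴 B).filter (fun 𝔲 => ¬IsGood 𝔴 𝔲),
        ∏ l, 1 / idealTotient K (𝔲 l) ≤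
      (k : ℝ) ^ 2 * (∑ 𝔞 ∈ G1 K 𝔴 B, 1 / idealTotient K 𝔞) ^ k *
        ∑ P ∈ ((finite_primeIdealsLE K B).toFinset).filter (fun P => ¬ P ∣ 𝔴),
          1 / idealTotient K P ^ 2 := by
  classical
  set L := ∑ 𝔞 ∈ G1 K 𝔴 B, 1 / idealTotient K 𝔞 with hL
  set TP := ((finite_primeIdealsLE K B).toFinset).filter (fun P => ¬ P ∣ 𝔴) with hTP
  have hTPprime : ∀ P ∈ TP, Prime P := fun P hP => by
    have h := (Finset.mem_filter.1 hP).1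
    rw [Set.Finite.mem_toFinset] at h
    exact Ideal.prime_of_isPrime h.2.1 h.1
  have hpos : ∀ 𝔞 ∈ G1 K 𝔴 B, 0 ≤ 1 / idealTotient K 𝔞 := fun 𝔞 ha =>
    (one_div_pos.2 (idealTotient_pos (mem_G1.1 ha).1.1)).le
  have hL0 : 0 ≤ L := Finset.sum_nonneg hpos
  have hw0 : ∀ 𝔲 ∈ (Fintype.piFinset fun _ : Fin k => G1 K 𝔴 B), 0 ≤ ∏ l, 1 / idealTotient K (𝔲 l) :=
    fun 𝔲 hu => Finset.prod_nonneg fun l _ => hpos _ (Fintype.mem_piFinset.1 hu l)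
  set Q : Finset ((Fin k × Fin k) × Ideal (𝓞 K)) := (Finset.univ : Finset (Fin k)).offDiag ×ˢ TP with hQ
  set C : ((Fin k × Fin k) × Ideal (𝓞 K)) → (Fin k → Ideal (𝓞 K)) → Prop :=
    fun q 𝔲 => q.2 ∣ 𝔲 q.1.1 ∧ q.2 ∣ 𝔲 q.1.2 with hC
  -- step 1: every bad tuple has a reason
  have step1 : ∑ 𝔲 ∈ (Fintype.piFinset fun _ : Fin k => G1 K 𝔴 B).filter (fun 𝔲 => ¬IsGood 𝔴 𝔲),
        ∏ l, 1 / idealTotient K (𝔲 l) ≤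
      ∑ 𝔲 ∈ (Fintype.piFinset fun _ : Fin k => G1 K 𝔴 B).filter (fun 𝔲 => ∃ q ∈ Q, C q 𝔲),
        ∏ l, 1 / idealTotient K (𝔲 l) := by
    refine Finset.sum_le_sum_of_subset_of_nonneg (fun 𝔲 hu => ?_)
      fun 𝔲 hu _ => hw0 𝔲 (Finset.mem_filter.1 hu).1
    rw [Finset.mem_filter] at hu ⊢
    refine ⟨hu.1, ?_⟩
    have hmem : ∀ i, 𝔲 i ∈ G1 K 𝔴 B := fun i => Fintype.mem_piFinset.1 hu.1 i
    obtain ⟨ij, hij, P, hP, h1, h2⟩ := exists_prime_dvd_two_of_not_isGood hmem hu.2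
    exact ⟨(ij, P), by rw [hQ, Finset.mem_product]; exact ⟨hij, hP⟩, ⟨h1, h2⟩⟩
  -- step 2: union bound
  have step2 : ∑ 𝔲 ∈ (Fintype.piFinset fun _ : Fin k => G1 K 𝔴 B).filter (fun 𝔲 => ∃ q ∈ Q, C q 𝔲),
        ∏ l, 1 / idealTotient K (𝔲 l) ≤
      ∑ q ∈ Q, ∑ 𝔲 ∈ (Fintype.piFinset fun _ : Fin k => G1 K 𝔴 B).filter (C q),
        ∏ l, 1 / idealTotient K (𝔲 l) :=
    MaynardSieve.sum_filter_exists_le Q _ C _ hw0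
  -- step 3: each reason costs `L^k/φ(P)²`
  have step3 : ∀ q ∈ Q, ∑ 𝔲 ∈ (Fintype.piFinset fun _ : Fin k => G1 K 𝔴 B).filter (C q),
        ∏ l, 1 / idealTotient K (𝔲 l) ≤ L ^ k / idealTotient K q.2 ^ 2 := by
    intro q hq
    rw [hQ, Finset.mem_product, Finset.mem_offDiag] at hq
    exact sum_prod_inv_idealTotient_filter_dvd_le (hTPprime q.2 hq.2) hq.1.2.2
  -- step 4: sum over the reasons
  have step4 : ∑ q ∈ Q, L ^ k / idealTotient K q.2 ^ 2 ≤
      (k : ℝ) ^ 2 * L ^ k * ∑ P ∈ TP, 1 / idealTotient K P ^ 2 := by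
    rw [hQ, Finset.sum_product]
    have hinner : ∀ ij ∈ (Finset.univ : Finset (Fin k)).offDiag,
        ∑ P ∈ TP, L ^ k / idealTotient K (((ij, P) : (Fin k × Fin k) × Ideal (𝓞 K)).2) ^ 2 =
          L ^ k * ∑ P ∈ TP, 1 / idealTotient K P ^ 2 := by
      intro ij _
      rw [Finset.mul_sum]
      exact Finset.sum_congr rfl fun P _ => by ring
    rw [Finset.sum_congr rfl hinner, Finset.sum_const, nsmul_eq_mul]
    have hS0 : 0 ≤ ∑ P ∈ TP, 1 / idealTotient K P ^ 2 := Finset.sum_nonneg fun _ _ => by positivity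
    have hcard : (((Finset.univ : Finset (Fin k)).offDiag.card : ℕ) : ℝ) ≤ (k : ℝ) ^ 2 := by
      rw [Finset.offDiag_card, Finset.card_univ, Fintype.card_fin]
      have : k * k - k ≤ k * k := Nat.sub_le _ _
      calc ((k * k - k : ℕ) : ℝ) ≤ ((k * k : ℕ) : ℝ) := by exact_mod_cast this
        _ = (k : ℝ) ^ 2 := by push_cast; ring
    calc ((Finset.univ : Finset (Fin k)).offDiag.card : ℝ) * (L ^ k * ∑ P ∈ TP, 1 / idealTotient K P ^ 2)
        ≤ (k : ℝ) ^ 2 * (L ^ k * ∑ P ∈ TP, 1 / idealTotient K P ^ 2) :=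
          mul_le_mul_of_nonneg_right hcard (by positivity)
      _ = _ := by ring
  exact step1.trans (step2.trans ((Finset.sum_le_sum step3).trans step4))

end Literature.NumberTheory.Sieve.MaynardNF
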